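import Literature.NumberTheory.EllipticCurves.SigmaSqDivisionBridgeProofs
import Literature.NumberTheory.EllipticCurves.PadicSigmaIsogenyCriterionProofs
import Literature.RingTheory.FormalGroups.UnitSubstitutionIntegrality
import Mathlib.NumberTheory.Padics.RingHoms
import Mathlib.Topology.Algebra.Polynomial
import HarnessLib

/-!
# The CM sigma function is `p`-integral: Perrin-Riou's Lemme 2 («everything squared») from a CM
# `2`-isogeny datum — the sigma-squared Mazur–Tate pair EXISTS and is the CM theta series
# (Perrin-Riou 1984, Ch. III §1.2; proofs only)

Topic `Literature/NumberTheory/EllipticCurves` (trunk T-NT-EC). Pure proof file (no definitions, no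
named facts), typer seat `bsd-goldfeld-ty` of the cell `bsd-goldfeld` (HOME
`run/shared/lean/pub/bsd-goldfeld/`, memo `TY-HYPOTHESES-AT-TWO.md` §13), bearing on route item
stmt-BirchSwinnertonDyer-19141 (Li–Tian–Yan–Zhu 2025 Thm. 1.1 at `p = 2`): the identification
(L1) «Mazur–Tate's `σ²` = the CM theta series `σ_v²` of Bernardi–Perrin-Riou» that the `p = 2`
height facts of that item need (memo §11.3, §12.2), proved here as a THEOREM by the argument printed
in B. Perrin-Riou, *Arithmétique des courbes elliptiques et théorie d'Iwasawa*, Mém. SMF 17 (1984),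
Ch. III §1.2:

* p. 53: for a CM curve, `P(z) = x(ℰ_v(z)) + (a₁² + 4a₂)/12`, `σ_v(z) = z·exp(-(s₂/2)z² - Σ_{k≥2} …)`
  — i.e. `σ_v` is THE normalised odd formal solution of the Mazur–Tate sigma equation
  `x + c = -D(Dσ/σ)` with the CM constant `c = (a₁² + 4a₂)/12 + s₂`, and «on peut calculer `s₂` de
  la manière suivante. Soit `α` un élément de `𝒪` qui n'est pas dans `ℤ`. Alors
  `(α² - αᾱ)s₂ = Σ_{r ∈ E_α, r ≠ 0} (x(r) + (a₁² + 4a₂)/12)`»;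
* p. 54: «pour `α` impair, `σ(αz)/σ(z)^{N(α)}` est égal à une fonction `g_α` rationnelle sur la
  courbe et de diviseur `Σ_{r∈E_α}((r) - (O))`» and **Lemme 2**: «La série `σ_v(L_v(t))` comme série
  en `t` appartient à `t(1 + tR⟦t⟧)`», proved (p. 54–55) from `h([π*]t) = h(t)ᵖ·c·u(t)`,
  `h = σ_v/t`, `π*` a unit of `R_v`, by comparing coefficients («`1 - (π*ᵐ - p)a_m tᵐ + ⋯`»).

We need the case `N(α) = 2` (`K = ℚ(√-7)`, `α = π* = (1 ± √-7)/2`, `p = 2` split — the CM curves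
with good ORDINARY reduction at `2`), where `α` is «pair» and, exactly as in Silverman's Remark on
Mazur–Tate's Thm. 3.1 at `p = 2` (tree: `PadicSigmaSq.lean`), everything must be SQUARED:
`g_α² = σ(αz)²/σ(z)⁴` IS a rational function, namely `α²·(x - x(r))`, `E_α = {O, r}`. With the
tree's vocabulary (`SatisfiesSigmaODE`, `IsFormallyOdd`, `formalLog`/`formalExp`,
`formalInvariantDerivation` `D = d/ω`, `logDeriv₂Num` `N(f) = f·D²f - (Df)²`,
`IsMazurTateSigmaSqPair`, `IsPadicInt`) the argument runs:

* §A `isPadicInt_formalExp_subst_C_mul_formalLog` — **the formal group of a `p`-integral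
  Weierstrass curve is a `ℤ_p`-module**: `[a](z) := exp_W(a·log_W z) ∈ ℤ_p⟦z⟧` for `a ∈ ℤ_p`
  (coefficients are polynomials in `a`, integral on the dense subset `ℕ ⊂ ℤ_p` since `[m] ∈ ℤ_p⟦z⟧`);
  `formalLog_subst_formalExp_subst_C_mul_formalLog`: `log_W([a]z) = a·log_W z`.
* §B calculus along `T` with `log_W(T) = ϖ·log_W` (chain rule `N(h∘T) = ϖ²·N(h)∘T`; `[z¹]T = ϖ`,
  `2[z²]T = a₁ϖ(1-ϖ)`) and the ratio datum of `A = X - ez²` (`X = z²x`) at a `2`-TORSION abscissa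
  `e`: `z²N(A) = (2κA + 2A² - 2tz⁴)·A`, `2t = 6e² + b₂e + b₄` — the cleared form of
  `-(log(x-e))'' = -2(x-e) + 2t/(x-e)`, from the tree's `x`-calculus (`FormalGroupXDerivativeProofs`).
* §C rigidity: `N(zᵏf₀)(zᵏg₀)² = N(zᵏg₀)(zᵏf₀)²` with equal `2`-jets forces `f₀ = g₀`.
* §D **`X_sq_mul_sq_subst_eq_of_cmTwoIsogeny` — the functional equation
  `z²·σ(T)² = ϖ²·σ⁴·(X - ez²)`** (`σ(ϖz)² = ϖ²σ(z)⁴(x(z) - e)`, Perrin-Riou's `g_α`, squared) for a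
  normalised odd formal solution `σ` with constant `c`, a series `T` with `log_W(T) = ϖ log_W`
  satisfying the cleared `x`-relation `ϖ²x(T) = x + t/(x-e) + r₀` of a `2`-isogeny with kernel
  `{O, (e,·)}` composed with an isomorphism back to the curve (Vélu), PROVIDED `c` is the CM
  constant `c = (e - r₀)/(ϖ² - 2)` — the two sides have second logarithmic derivatives differing by
  the constant `2r₀ + (2ϖ² - 4)c - 2e` (this is Perrin-Riou's formula for `s₂` at `N(α) = 2`).
* §E **`isMazurTateSigmaSqPair_sq_of_cmTwoIsogeny` (and `…_two` at `p = 2`)** — with `V`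
  `p`-integral, `T ∈ zℤ_p⟦z⟧`, `ϖ ∈ ℤ_pˣ` (`ϖᵐ - 2` units), `e ∈ ℤ_p`: `h = (σ/z)²` satisfies
  `h(T) = h²·u`, `u ∈ ℤ_p⟦z⟧`, so `h ∈ ℤ_p⟦z⟧` by Perrin-Riou's coefficient comparison
  (`Literature/RingTheory/FormalGroups/UnitSubstitutionIntegrality`), and `(σ², c)` is a
  sigma-squared pair (`IsMazurTateSigmaSqPair`): EXISTENCE of the squared Mazur–Tate pair with an
  explicit identification of `Σ` as the square of the formal solution at the CM constant.

The CM `2`-isogeny datum for `X₀(49) = [1,-1,0,-2,-1]` at `p = 2` (`ϖ = (1+√-7)/2 ∈ ℤ₂ˣ`,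
`e = (-5+√-7)/8`, `r₀ = e`, hence `c = 0`, i.e. `s₂ = 1/4` on the minimal model = Perrin-Riou's
table value `s₂ = 1/2` for `y² = 4x³ - 35x - 49`, p. 54) is supplied in the sequel
`X049CMSigmaSqTwoProofs.lean`.

## Sources

* B. Perrin-Riou, Mém. Soc. Math. France (N.S.) 17 (1984), Ch. III §1.2 (pp. 53–55: `σ_v`, `s₂`,
  `g_α`, Lemme 2 and its proof). [Perrinriou1984]
* B. Mazur, J. Tate, *The `p`-adic sigma function*, Duke Math. J. 62 (1991), §3 (Thm. 3.1).
  [MazurTate1991]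
* J. H. Silverman, Math. Ann. 332 (2005) §5 Rem. 2 (`p = 2`: «everything squared»).
  [Silverman2005DivPoly]
* J. Vélu, C. R. Acad. Sci. Paris 273 (1971) 238–241 (the `2`-isogeny `x ↦ x + t/(x - e)`). [Velu1971]
* J. H. Silverman, *AEC* (2009) IV.1–IV.5 (formal group, `log`, `exp`, `[m]`). [SilvermanAEC2009]

## Design notes

Pure proof file over `ℚ_p` (any prime `p`; the `p = 2` specialisation only discharges the unit
condition). No definitions: `[a]` is written `V.formalExp.subst (C a * V.formalLog)` throughout. The
`x`-relation hypothesis `hx` is the cleared identity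
`ϖ²·X(T)·z²A = T²·(X·A + t z⁴ + r₀ z² A)`, `A = X - ez²`, i.e. `ϖ²x(T) = x + t/(x-e) + r₀`.
-/

noncomputable section

open PowerSeries Literature.NumberTheory.EllipticCurves

namespace WeierstrassCurve

/-! ### §A. `ℤ_p`-multiplication on the formal group: `[a](z) = exp_W(a·log_W z) ∈ ℤ_p⟦z⟧` -/

section ZpMul

variable {p : ℕ} [Fact p.Prime] (V : WeierstrassCurve ℚ_[p])

/-- `a·log_W` has no constant term. [folklore] -/
private theorem constantCoeff_C_mul_formalLog (a : ℚ_[p]) : constantCoeff (C a * V.formalLog) = 0 := by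
  rw [map_mul, constantCoeff_formalLog, mul_zero]

/-- `[a](0) = 0` for `[a] = exp_W(a log_W)`. [cite: SilvermanAEC2009, IV.2.3] -/
theorem constantCoeff_formalExp_subst_C_mul_formalLog (a : ℚ_[p]) :
    constantCoeff (V.formalExp.subst (C a * V.formalLog)) = 0 := by
  rw [Literature.RingTheory.FormalGroups.constantCoeff_subst_of_constantCoeff_eq_zero
    (V.constantCoeff_C_mul_formalLog a), constantCoeff_formalExp]

/-- **`log_W([a] z) = a · log_W(z)`** for `[a] = exp_W(a log_W)`. [Silverman AEC IV.5 (the formal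
logarithm is an isomorphism to the additive group over a `ℚ`-algebra)] [cite: SilvermanAEC2009, IV.5.6] -/
theorem formalLog_subst_formalExp_subst_C_mul_formalLog (a : ℚ_[p]) :
    V.formalLog.subst (V.formalExp.subst (C a * V.formalLog)) = C a * V.formalLog := by
  have hg : HasSubst (C a * V.formalLog) := HasSubst.of_constantCoeff_zero' (V.constantCoeff_C_mul_formalLog a)
  rw [← subst_comp_subst_apply (HasSubst.of_constantCoeff_zero' V.constantCoeff_formalExp) hg,
    V.formalLog_subst_formalExp, subst_X hg]

/-- The coefficient of `zⁿ` in `[a](z) = exp_W(a·log_W z)` is a POLYNOMIAL in `a`: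
`[zⁿ][a] = Σ_{d ≤ n} [zᵈ]exp_W · [zⁿ](log_Wᵈ) · aᵈ`. [folklore] -/
private theorem coeff_formalExp_subst_C_mul_formalLog_eq_eval (a : ℚ_[p]) (n : ℕ) :
    coeff n (V.formalExp.subst (C a * V.formalLog)) =
      (∑ d ∈ Finset.range (n + 1),
        Polynomial.C (coeff d V.formalExp * coeff n (V.formalLog ^ d)) * Polynomial.X ^ d).eval a := by
  rw [coeff_subst_eq_sum_range (V.constantCoeff_C_mul_formalLog a), Polynomial.eval_finsetSum]
  refine Finset.sum_congr rfl fun d _ => ?_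
  rw [mul_pow, ← map_pow, coeff_C_mul, Polynomial.eval_mul, Polynomial.eval_C, Polynomial.eval_pow,
    Polynomial.eval_X]
  ring

/-- For `a = m ∈ ℕ`, `[a] = exp_W(m·log_W) = [m]` is the formal multiplication-by-`m`, which has
`p`-integral coefficients on a `p`-integral model. [Silverman AEC IV.2.3, IV.4] [folklore] -/
private theorem isPadicInt_formalExp_subst_natCast_mul_formalLog [V.IsIntegral ℤ_[p]] (m : ℕ) :
    IsPadicInt (V.formalExp.subst (C (m : ℚ_[p]) * V.formalLog)) := by
  rw [map_natCast, ← nsmul_eq_mul, V.formalExp_subst_nsmul_formalLog m]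
  exact V.isPadicInt_formalMul m

/-- **The formal group of a `p`-integral Weierstrass curve is a `ℤ_p`-module: for `a ∈ ℤ_p` the
series `[a](z) = exp_W(a·log_W z)` has coefficients in `ℤ_p`.** Each coefficient is a polynomial in
`a` (`coeff_formalExp_subst_C_mul_formalLog_eq_eval`) which takes `p`-integral values at every
`a ∈ ℕ` (`[m] ∈ ℤ_p⟦z⟧`); since `ℕ` is dense in `ℤ_p`, polynomial maps are continuous and the unit
ball is closed, it takes `p`-integral values on all of `ℤ_p`. [Silverman AEC IV.2.3, IV.4, IV.6
(the formal group over a complete local ring); Lubin–Tate / Hazewinkel, *Formal Groups* §A.4 («the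
`ℤ_p`-module structure `[a](X)`»)] [cite: SilvermanAEC2009, IV.2.3] -/
theorem isPadicInt_formalExp_subst_C_mul_formalLog [V.IsIntegral ℤ_[p]] {a : ℚ_[p]} (ha : ‖a‖ ≤ 1) :
    IsPadicInt (V.formalExp.subst (C a * V.formalLog)) := by
  rw [isPadicInt_iff_coeff]
  intro n
  set Q : Polynomial ℚ_[p] := ∑ d ∈ Finset.range (n + 1),
    Polynomial.C (coeff d V.formalExp * coeff n (V.formalLog ^ d)) * Polynomial.X ^ d with hQ
  -- the property `‖Q(b)‖ ≤ 1` is closed in `b ∈ ℤ_p` and holds on `ℕ`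
  have hclosed : IsClosed {b : ℤ_[p] | ‖Q.eval (b : ℚ_[p])‖ ≤ 1} :=
    isClosed_le ((continuous_norm.comp (Q.continuous.comp continuous_subtype_val))) continuous_const
  have hnat : ∀ m : ℕ, ‖Q.eval ((m : ℤ_[p]) : ℚ_[p])‖ ≤ 1 := fun m => by
    rw [PadicInt.coe_natCast, hQ, ← V.coeff_formalExp_subst_C_mul_formalLog_eq_eval]
    exact isPadicInt_iff_coeff.mp (V.isPadicInt_formalExp_subst_natCast_mul_formalLog m) n
  have key : ‖Q.eval ((⟨a, ha⟩ : ℤ_[p]) : ℚ_[p])‖ ≤ 1 :=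
    PadicInt.denseRange_natCast.induction_on (p := fun b : ℤ_[p] => ‖Q.eval (b : ℚ_[p])‖ ≤ 1)
      ⟨a, ha⟩ hclosed hnat
  rw [V.coeff_formalExp_subst_C_mul_formalLog_eq_eval, ← hQ]
  exact key

end ZpMul

/-! ### §B. Calculus: the chain rule along `T` with `log_W(T) = ϖ·log_W`, ratio data -/

section Calculus

variable {p : ℕ} [Fact p.Prime] (V : WeierstrassCurve ℚ_[p])

/-- From `log_W(T) = ϖ·log_W` (and `T(0) = 0`): `ω(T)·T' = ϖ·ω`, i.e. `T` multiplies the invariant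
differential by `ϖ`. [Silverman AEC IV.4–IV.5] [folklore] -/
private theorem formalInvDiff_subst_mul_derivative_of_formalLog_subst {T : ℚ_[p]⟦X⟧} {ϖ : ℚ_[p]}
    (hT0 : constantCoeff T = 0) (hlog : V.formalLog.subst T = C ϖ * V.formalLog) :
    V.formalInvDiff.subst T * d⁄dX ℚ_[p] T = C ϖ * V.formalInvDiff := by
  have hs : HasSubst T := HasSubst.of_constantCoeff_zero' hT0
  have h := congrArg (d⁄dX ℚ_[p]) hlog
  rw [derivative_subst ℚ_[p] hs, derivative_formalLog, Derivation.leibniz, derivative_C, smul_zero,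
    add_zero, smul_eq_mul, derivative_formalLog] at h
  rw [formalInvDiff_eq_formalOmega]
  exact h

/-- The linear coefficient of `T`: `[z¹]T = ϖ`. [folklore] -/
private theorem coeff_one_of_formalLog_subst {T : ℚ_[p]⟦X⟧} {ϖ : ℚ_[p]}
    (hT0 : constantCoeff T = 0) (hlog : V.formalLog.subst T = C ϖ * V.formalLog) : coeff 1 T = ϖ := by
  have h := congrArg (coeff 1) hlog
  rw [coeff_subst_eq_sum_range hT0, Finset.sum_range_succ, Finset.sum_range_succ, Finset.sum_range_zero,
    zero_add, pow_zero, coeff_one, if_neg one_ne_zero, zero_mul, zero_add, pow_one,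
    coeff_one_formalLog, mul_one, coeff_C_mul, coeff_one_formalLog, mul_one] at h
  exact h

/-- `[z²] log_W = a₁/2` (`log_W' = ω = 1 + a₁z + ⋯`). [Silverman AEC IV.1, IV.4] [folklore] -/
private theorem two_mul_coeff_two_formalLog : 2 * coeff 2 V.formalLog = V.a₁ := by
  have h := congrArg (coeff 1) V.derivative_formalLog
  rw [coeff_derivative, ← formalInvDiff_eq_formalOmega, coeff_one_formalInvDiff] at h
  have e : coeff (1 + 1) V.formalLog * ((1 : ℕ) + 1 : ℚ_[p]) = V.a₁ := by exact_mod_cast h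
  norm_num at e
  linear_combination e

/-- `[z²](T²) = ([z¹]T)²` for `T(0) = 0`. [folklore] -/
private theorem coeff_two_sq_of_constantCoeff_eq_zero {T : ℚ_[p]⟦X⟧} (hT0 : constantCoeff T = 0) :
    coeff 2 (T ^ 2) = coeff 1 T ^ 2 := by
  have h := Literature.RingTheory.FormalGroups.coeff_pow_mul_of_constantCoeff_eq_zero hT0 1 2
  rwa [mul_one, map_one, mul_one] at h

/-- The quadratic coefficient of `T`: `2·[z²]T = a₁·ϖ(1 - ϖ)`. [folklore] -/
private theorem two_mul_coeff_two_of_formalLog_subst {T : ℚ_[p]⟦X⟧} {ϖ : ℚ_[p]}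
    (hT0 : constantCoeff T = 0) (hlog : V.formalLog.subst T = C ϖ * V.formalLog) :
    2 * coeff 2 T = V.a₁ * ϖ * (1 - ϖ) := by
  have h1 := V.coeff_one_of_formalLog_subst hT0 hlog
  have hℓ := V.two_mul_coeff_two_formalLog
  have h := congrArg (coeff 2) hlog
  rw [coeff_subst_eq_sum_range hT0, Finset.sum_range_succ, Finset.sum_range_succ, Finset.sum_range_succ,
    Finset.sum_range_zero, zero_add, pow_zero, coeff_one, if_neg two_ne_zero, zero_mul, zero_add, pow_one,
    coeff_one_formalLog, mul_one, coeff_C_mul, coeff_two_sq_of_constantCoeff_eq_zero hT0, h1] at h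
  linear_combination 2 * h + (ϖ - ϖ ^ 2) * hℓ

/-- **`N(h ∘ T) = ϖ² · N(h) ∘ T`** for the second logarithmic derivative `N(f) = f·D²f - (Df)²`
along `D = d/ω`, when `log_W(T) = ϖ log_W` (chain rule `D(h∘T) = ϖ·(Dh)∘T`).
[Blakestad–Grant 2023, §2.2 (chain rule for `D`)] [folklore] -/
private theorem logDeriv₂Num_subst {T : ℚ_[p]⟦X⟧} {ϖ : ℚ_[p]} (hT0 : constantCoeff T = 0)
    (hlog : V.formalLog.subst T = C ϖ * V.formalLog) (h : ℚ_[p]⟦X⟧) :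
    logDeriv₂Num V.formalInvariantDerivation (h.subst T) =
      C ϖ ^ 2 * (logDeriv₂Num V.formalInvariantDerivation h).subst T := by
  have hs : HasSubst T := HasSubst.of_constantCoeff_zero' hT0
  have hTω := V.formalInvDiff_subst_mul_derivative_of_formalLog_subst hT0 hlog
  have hc : ∀ g : ℚ_[p]⟦X⟧, V.formalInvariantDerivation (g.subst T) =
      C ϖ * (V.formalInvariantDerivation g).subst T :=
    fun g => V.formalInvariantDerivation_subst_of_formalInvDiff_subst hT0 hTω g
  rw [logDeriv₂Num_def, logDeriv₂Num_def, hc, V.formalInvariantDerivation_C_mul, hc, subst_sub hs,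
    subst_mul hs, subst_pow hs]
  ring

/-- `N(z) = κ := z·Dη - η²` and the ratio datum of `z²`: `N(z²)·z² = 2κ·(z²)²`. [folklore] -/
private theorem logDeriv₂Num_X_sq_ratio :
    logDeriv₂Num V.formalInvariantDerivation (X ^ 2) * X ^ 2 =
      (2 * (X * V.formalInvariantDerivation V.formalEta - V.formalEta ^ 2)) * (X ^ 2) ^ 2 := by
  rw [logDeriv₂Num_sq, logDeriv₂Num_def, formalInvariantDerivation_X]
  ring

/-- **Ratio datum of `A = X - e z²` (`= z²(x - e)`) at a `2`-TORSION abscissa `e`**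
(`4e³ + b₂e² + 2b₄e + b₆ = 0`): `z²·N(A) = (2κ·A + 2A² - 2t z⁴)·A` with `2t = 6e² + b₂e + b₄` —
the cleared form of `-(log(x - e))'' = -2(x - e) + 2t/(x - e)` (the logarithmic derivative of the
`x`-coordinate of Vélu's `2`-isogeny with kernel `{O, (e, ·)}`). From the tree's `x`-calculus
`zD(X) = 2ηX + Ỹ`, `zD(Ỹ) = 3ηỸ + 6X² + b₂z²X + b₄z⁴`, `Ỹ² = 4X³ + b₂z²X² + 2b₄z⁴X + b₆z⁶`.
[Vélu 1971; Silverman AEC III.4 (2-isogeny formulas)] [folklore] -/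
private theorem X_sq_mul_logDeriv₂Num_formalXMulSq_sub {e t : ℚ_[p]}
    (he : 4 * e ^ 3 + V.b₂ * e ^ 2 + 2 * V.b₄ * e + V.b₆ = 0) (ht : 2 * t = 6 * e ^ 2 + V.b₂ * e + V.b₄) :
    X ^ 2 * logDeriv₂Num V.formalInvariantDerivation (V.formalXMulSq - C e * X ^ 2) =
      (2 * (X * V.formalInvariantDerivation V.formalEta - V.formalEta ^ 2) * (V.formalXMulSq - C e * X ^ 2) +
        2 * (V.formalXMulSq - C e * X ^ 2) ^ 2 - 2 * C t * X ^ 4) * (V.formalXMulSq - C e * X ^ 2) := by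
  have hDX : V.formalInvariantDerivation X = V.formalEta := V.formalInvariantDerivation_X
  have hD2 : V.formalInvariantDerivation (2 : ℚ_[p]⟦X⟧) = 0 := Derivation.map_natCast _ 2
  have hF1 := V.X_mul_formalInvariantDerivation_formalXMulSq
  have hF2 := V.X_mul_formalInvariantDerivation_formalYTilde
  have hF3 := V.formalYTilde_sq
  set Yt := (C V.a₁ * X - 2) * V.formalXMulSq + C V.a₃ * X ^ 3 with hYt
  set Xs := V.formalXMulSq with hXs
  set η := V.formalEta with hη
  -- `z²·D²X`
  have hQ0 := congrArg V.formalInvariantDerivation hF1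
  simp only [Derivation.leibniz, map_add, hDX, hD2, smul_eq_mul] at hQ0
  have hQ : X ^ 2 * V.formalInvariantDerivation (V.formalInvariantDerivation Xs) =
      2 * X * V.formalInvariantDerivation η * Xs + 2 * η ^ 2 * Xs + 4 * η * Yt + 6 * Xs ^ 2 +
        C V.b₂ * X ^ 2 * Xs + C V.b₄ * X ^ 4 := by
    linear_combination X * hQ0 + η * hF1 + hF2
  -- constants
  have heC : 4 * (C e : ℚ_[p]⟦X⟧) ^ 3 + C V.b₂ * C e ^ 2 + 2 * C V.b₄ * C e + C V.b₆ = 0 := by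
    have := congrArg (C (R := ℚ_[p])) he
    simpa only [map_add, map_mul, map_pow, map_ofNat, map_zero] using this
  have htC : 2 * (C t : ℚ_[p]⟦X⟧) = 6 * C e ^ 2 + C V.b₂ * C e + C V.b₄ := by
    have := congrArg (C (R := ℚ_[p])) ht
    simpa only [map_add, map_mul, map_pow, map_ofNat] using this
  -- `D A`, `D² A`
  have hDA : V.formalInvariantDerivation (Xs - C e * X ^ 2) =
      V.formalInvariantDerivation Xs - 2 * C e * X * η := by
    rw [map_sub, V.formalInvariantDerivation_C_mul, Derivation.leibniz_pow, hDX]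
    simp only [nsmul_eq_mul, smul_eq_mul, Nat.cast_ofNat, Nat.add_one_sub_one, pow_one]
    ring
  have hDDA : V.formalInvariantDerivation (V.formalInvariantDerivation (Xs - C e * X ^ 2)) =
      V.formalInvariantDerivation (V.formalInvariantDerivation Xs) -
        2 * C e * (η * η + X * V.formalInvariantDerivation η) := by
    rw [hDA, map_sub]
    have : V.formalInvariantDerivation (2 * C e * X * η) =
        2 * C e * (η * η + X * V.formalInvariantDerivation η) := by
      simp only [Derivation.leibniz, hDX, hD2, formalInvariantDerivation_C, smul_eq_mul]
      ring
    rw [this]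
  rw [logDeriv₂Num_def, hDDA, hDA]
  linear_combination (-(X * V.formalInvariantDerivation Xs) - (2 * η * Xs + Yt) + 4 * C e * X ^ 2 * η) * hF1 +
    (Xs - C e * X ^ 2) * hQ + (-1 : ℚ_[p]⟦X⟧) * hF3 + (-X ^ 6) * heC + (X ^ 4 * (Xs - C e * X ^ 2)) * htC

end Calculus

/-! ### §C. Rigidity: equal second logarithmic derivatives and equal `2`-jets force equality -/

section Rigidity

variable {p : ℕ} [Fact p.Prime] (V : WeierstrassCurve ℚ_[p])

/-- `D`-constants are constants: `Df = 0 ⇒ f = f(0)` (`D = η·d/dz`, `η` a unit, characteristic `0`).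
[folklore] -/
private theorem eq_C_of_formalInvariantDerivation_eq_zero {f : ℚ_[p]⟦X⟧}
    (h : V.formalInvariantDerivation f = 0) : f = C (constantCoeff f) := by
  rw [formalInvariantDerivation_apply] at h
  have h' : d⁄dX ℚ_[p] f = 0 := (V.isUnit_formalEta.mul_right_eq_zero).mp h
  ext n
  rcases n with _ | n
  · simp
  · rw [coeff_C, if_neg (Nat.succ_ne_zero n)]
    have e := congrArg (coeff n) h'
    rw [coeff_derivative, map_zero] at e
    exact (mul_eq_zero.mp e).resolve_right (by exact_mod_cast Nat.succ_ne_zero n)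

/-- **Rigidity.** If `N(q) = 0` (`N(f) = f·D²f - (Df)²`), `q(0) = 1` and `[z¹]q = 0`, then `q = 1`:
`D(Dq/q) = N(q)/q² = 0`, so `Dq/q` is the constant `(Dq/q)(0) = [z¹]q = 0`. [Mazur–Tate 1991, §3
(the constants of integration)] [folklore] -/
private theorem eq_one_of_logDeriv₂Num_eq_zero {q : ℚ_[p]⟦X⟧} (hq0 : constantCoeff q = 1)
    (hq1 : coeff 1 q = 0) (hN : logDeriv₂Num V.formalInvariantDerivation q = 0) : q = 1 := by
  set D := V.formalInvariantDerivation with hD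
  have hqi : q * invOfUnit q 1 = 1 := mul_invOfUnit q 1 (by rw [hq0, Units.val_one])
  set iq := invOfUnit q 1 with hiq
  have hqne : q ≠ 0 := fun h0 => by rw [h0, map_zero] at hq0; exact zero_ne_one hq0
  -- `D(iq) = -iq²·Dq`
  have hDi : q * D iq + iq * D q = 0 := by
    have e := congrArg D hqi
    rwa [Derivation.leibniz, smul_eq_mul, smul_eq_mul, Derivation.map_one_eq_zero] at e
  -- `L = Dq·iq` has `DL = 0`
  set L := D q * iq with hL
  have hDL : D L = 0 := by
    have e : q ^ 2 * D L = 0 := by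
      rw [logDeriv₂Num_def] at hN
      have : q ^ 2 * D L = (q * D (D q) - D q ^ 2) * (q * iq) + q * D q * (q * D iq + iq * D q) := by
        rw [hL, Derivation.leibniz, smul_eq_mul, smul_eq_mul]; ring
      rw [this, hN, hDi, zero_mul, mul_zero, add_zero]
    exact (mul_eq_zero.mp e).resolve_left (pow_ne_zero _ hqne)
  have hL0 : constantCoeff L = 0 := by
    rw [hL, map_mul, hD, formalInvariantDerivation_apply, map_mul, constantCoeff_formalEta, one_mul,
      ← coeff_zero_eq_constantCoeff_apply (d⁄dX ℚ_[p] q), coeff_derivative, zero_add, hq1]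
    simp
  have hLz : L = 0 := by
    have e := V.eq_C_of_formalInvariantDerivation_eq_zero hDL
    rwa [hL0, map_zero] at e
  have hDq : D q = 0 := by
    calc D q = D q * (q * iq) := by rw [hqi, mul_one]
      _ = L * q := by rw [hL]; ring
      _ = 0 := by rw [hLz, zero_mul]
  have e := V.eq_C_of_formalInvariantDerivation_eq_zero hDq
  rw [hq0, map_one] at e
  exact e

/-- **Equal second logarithmic derivatives and equal `2`-jets after a common power of `z` force
equality.** If `N(zᵏf₀)·(zᵏg₀)² = N(zᵏg₀)·(zᵏf₀)²`, `f₀(0) = g₀(0) ≠ 0` and `[z¹]f₀ = [z¹]g₀`, then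
`f₀ = g₀`. (`N(zᵏ·h) = N(zᵏ)h² + z²ᵏN(h)`, so the hypothesis is `N(f₀)g₀² = N(g₀)f₀²`; then
`q = f₀/g₀` has `N(q) = 0` and `q(0) = 1`, `[z¹]q = 0`.) [Blakestad–Grant 2023, proof of Prop. 14
(Wronskian argument); Mazur–Tate 1991, §3] [folklore] -/
private theorem eq_of_logDeriv₂Num_X_pow_mul_eq {f₀ g₀ : ℚ_[p]⟦X⟧} (k : ℕ)
    (h0 : constantCoeff f₀ = constantCoeff g₀) (hne : constantCoeff g₀ ≠ 0) (h1 : coeff 1 f₀ = coeff 1 g₀)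
    (hN : logDeriv₂Num V.formalInvariantDerivation (X ^ k * f₀) * (X ^ k * g₀) ^ 2 =
      logDeriv₂Num V.formalInvariantDerivation (X ^ k * g₀) * (X ^ k * f₀) ^ 2) : f₀ = g₀ := by
  set D := V.formalInvariantDerivation with hD
  have hg0ne : g₀ ≠ 0 := fun h => by rw [h, map_zero] at hne; exact hne rfl
  -- (i) `N(f₀)g₀² = N(g₀)f₀²`
  have hi : logDeriv₂Num D f₀ * g₀ ^ 2 = logDeriv₂Num D g₀ * f₀ ^ 2 := by
    have e : X ^ (4 * k) * (logDeriv₂Num D f₀ * g₀ ^ 2 - logDeriv₂Num D g₀ * f₀ ^ 2) = 0 := by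
      rw [logDeriv₂Num_mul, logDeriv₂Num_mul] at hN
      linear_combination hN
    exact sub_eq_zero.mp ((mul_eq_zero.mp e).resolve_left (pow_ne_zero _ X_ne_zero))
  -- (ii) `q = f₀·g₀⁻¹`
  have hgi : g₀ * invOfUnit g₀ (Units.mk0 _ hne) = 1 := mul_invOfUnit g₀ _ (Units.val_mk0 _).symm
  set ig := invOfUnit g₀ (Units.mk0 _ hne) with hig
  have hig0 : constantCoeff ig = (constantCoeff g₀)⁻¹ := by
    rw [hig, constantCoeff_invOfUnit, Units.val_inv_eq_inv_val, Units.val_mk0]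
  set q := f₀ * ig with hq
  have hfq : f₀ = q * g₀ := by
    calc f₀ = f₀ * (g₀ * ig) := by rw [hgi, mul_one]
      _ = q * g₀ := by rw [hq]; ring
  have hq0 : constantCoeff q = 1 := by
    rw [hq, map_mul, hig0, h0, mul_inv_cancel₀ hne]
  have hq1 : coeff 1 q = 0 := by
    have e := congrArg (coeff 1) hfq
    rw [coeff_one_mul_eq, coeff_zero_eq_constantCoeff_apply, hq0, one_mul, coeff_zero_eq_constantCoeff_apply,
      h1] at e
    have e' : coeff 1 q * constantCoeff g₀ = 0 := by linear_combination -e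
    exact (mul_eq_zero.mp e').resolve_right hne
  -- (iii) `N(q) = 0`
  have hNq : logDeriv₂Num D q = 0 := by
    have e : logDeriv₂Num D q * g₀ ^ 4 = 0 := by
      rw [hfq, logDeriv₂Num_mul] at hi
      linear_combination hi
    exact (mul_eq_zero.mp e).resolve_right (pow_ne_zero _ hg0ne)
  -- (iv) `q = 1`
  have hq1' := V.eq_one_of_logDeriv₂Num_eq_zero hq0 hq1 hNq
  rw [hfq, hq1', one_mul]

end Rigidity

/-! ### §D. The functional equation `z²σ(T)² = ϖ²σ⁴·(X - ez²)` of the CM sigma function -/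

section FunctionalEquation

variable {p : ℕ} [Fact p.Prime] (V : WeierstrassCurve ℚ_[p])

/-- `(C r)(T) = C r` (with Mathlib's `subst_C` landing in `MvPowerSeries.C`). [folklore] -/
private theorem C_subst' {T : ℚ_[p]⟦X⟧} (r : ℚ_[p]) : (C r : ℚ_[p]⟦X⟧).subst T = C r := by
  rw [subst_C]; rfl

/-- `[z¹](σ ∘ T) = ϖ` and `2[z²](σ ∘ T) = a₁ϖ` for a normalised odd `σ` (`2[z²]σ = a₁`) and `T` with
`log_W(T) = ϖ log_W` (`2[z²]T = a₁ϖ(1-ϖ)`). [folklore] -/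
private theorem coeff_sigma_subst {σ T : ℚ_[p]⟦X⟧} {ϖ : ℚ_[p]} (hσ0 : constantCoeff σ = 0)
    (hσ1 : coeff 1 σ = 1) (hodd : V.IsFormallyOdd σ) (hT0 : constantCoeff T = 0)
    (hlog : V.formalLog.subst T = C ϖ * V.formalLog) :
    constantCoeff (σ.subst T) = 0 ∧ coeff 1 (σ.subst T) = ϖ ∧ 2 * coeff 2 (σ.subst T) = V.a₁ * ϖ := by
  have h1 := V.coeff_one_of_formalLog_subst hT0 hlog
  have h2 := V.two_mul_coeff_two_of_formalLog_subst hT0 hlog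
  have hσ2 := V.two_mul_coeff_two_of_isFormallyOdd hodd hσ0 hσ1
  refine ⟨?_, ?_, ?_⟩
  · rw [Literature.RingTheory.FormalGroups.constantCoeff_subst_of_constantCoeff_eq_zero hT0, hσ0]
  · rw [coeff_subst_eq_sum_range hT0, Finset.sum_range_succ, Finset.sum_range_succ, Finset.sum_range_zero,
      zero_add, pow_zero, coeff_one, if_neg one_ne_zero, zero_mul, zero_add, pow_one, h1, hσ1, mul_one]
  · rw [coeff_subst_eq_sum_range hT0, Finset.sum_range_succ, Finset.sum_range_succ, Finset.sum_range_succ,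
      Finset.sum_range_zero, zero_add, pow_zero, coeff_one, if_neg two_ne_zero, zero_mul, zero_add, pow_one,
      hσ1, mul_one, coeff_two_sq_of_constantCoeff_eq_zero hT0, h1]
    linear_combination h2 + ϖ ^ 2 * hσ2

/-- **The functional equation of the CM sigma function along an étale `2`-isogeny** (the algebraic
content of Perrin-Riou 1984, Ch. III §1.2: «pour `α` impair, `σ(αz)/σ(z)^{N(α)}` est égal à une
fonction `g_α` rationnelle sur la courbe et de diviseur `Σ_{r ∈ E_α}((r) - (O))`», here for an
endomorphism of degree `2` and SQUARED, so that `g²` is the function `ϖ²(x - e)`): let `σ = z + ⋯`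
be a normalised odd formal solution of the Mazur–Tate sigma equation `x + c = -D(Dσ/σ)` of
`V/ℚ_p`; let `T ∈ zℚ_p⟦z⟧` with `log_W(T) = ϖ·log_W` (so `T = [ϖ]` on the formal group, `ϖ ≠ 0`)
satisfy the `x`-relation of a `2`-isogeny composed with an isomorphism back to `V`,
`ϖ²·x(T) = x + t/(x - e) + r₀` with `(e, ·)` a `2`-torsion point (`4e³ + b₂e² + 2b₄e + b₆ = 0`,
`2t = 6e² + b₂e + b₄`, Vélu), stated with poles cleared (`X = z²x`); and suppose the constant of
the sigma equation is the CM constant, `c = (e - r₀)/(ϖ² - 2)`. Then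
**`z²·σ(T)² = ϖ²·σ⁴·(X - e z²)`**, i.e. `σ(ϖ z)² = ϖ² σ(z)⁴ (x(z) - e)`. Proof: both sides have
the same second logarithmic derivative along `D = d/ω` (`N(σ∘T) = ϖ²N(σ)∘T` by the chain rule, the
sigma equation at `z` and at `T`, and `-(log(x - e))'' = -2(x-e) + 2t/(x-e)` — the two differ by
the constant `2r₀ + (2ϖ² - 4)c - 2e = 0`) and the same `2`-jet `ϖ²z⁴(1 + a₁z + ⋯)`, so they agree
by rigidity. [Perrin-Riou 1984, Ch. III §1.2 (p. 54: `σ(αz)/σ(z)^{Nα} = g_α`; p. 53: the CM value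
`(α² - N(α))s₂ = Σ_{r ∈ E_α ∖ 0} ℘(r)` of the constant); Mazur–Tate 1991, §3]
[cite: Perrinriou1984, Ch. III §1.2 Lemme 3 (ii)] -/
theorem X_sq_mul_sq_subst_eq_of_cmTwoIsogeny {σ T : ℚ_[p]⟦X⟧} {c ϖ e t r₀ : ℚ_[p]}
    (hσ0 : constantCoeff σ = 0) (hσ1 : coeff 1 σ = 1) (hodd : V.IsFormallyOdd σ)
    (hODE : V.SatisfiesSigmaODE σ c) (hT0 : constantCoeff T = 0)
    (hlog : V.formalLog.subst T = C ϖ * V.formalLog) (hϖ : ϖ ≠ 0)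
    (he : 4 * e ^ 3 + V.b₂ * e ^ 2 + 2 * V.b₄ * e + V.b₆ = 0) (ht : 2 * t = 6 * e ^ 2 + V.b₂ * e + V.b₄)
    (hx : C ϖ ^ 2 * V.formalXMulSq.subst T * (X ^ 2 * (V.formalXMulSq - C e * X ^ 2)) =
      T ^ 2 * (V.formalXMulSq * (V.formalXMulSq - C e * X ^ 2) + C t * X ^ 4 +
        C r₀ * X ^ 2 * (V.formalXMulSq - C e * X ^ 2)))
    (hκ : r₀ + (ϖ ^ 2 - 2) * c - e = 0) :
    X ^ 2 * σ.subst T ^ 2 = C ϖ ^ 2 * σ ^ 4 * (V.formalXMulSq - C e * X ^ 2) := by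
  have hs : HasSubst T := HasSubst.of_constantCoeff_zero' hT0
  set D := V.formalInvariantDerivation with hD
  set Xs := V.formalXMulSq with hXs
  set A := V.formalXMulSq - C e * X ^ 2 with hA
  set η := V.formalEta with hη
  set κX := X * D η - η ^ 2 with hκX
  set σT := σ.subst T with hσT
  set XsT := V.formalXMulSq.subst T with hXsT
  obtain ⟨hσT0, hσT1, hσT2⟩ := V.coeff_sigma_subst hσ0 hσ1 hodd hT0 hlog
  have hT1 := V.coeff_one_of_formalLog_subst hT0 hlog
  have hσ2 := V.two_mul_coeff_two_of_isFormallyOdd hodd hσ0 hσ1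
  -- ratio data
  have rdσ : X ^ 2 * logDeriv₂Num D σ = -(Xs + C c * X ^ 2) * σ ^ 2 :=
    V.X_sq_mul_logDeriv₂Num_of_satisfiesSigmaODE hσ0 hσ1 hODE
  have rdσT : logDeriv₂Num D σT * T ^ 2 = (-(C ϖ ^ 2 * (XsT + C c * T ^ 2))) * σT ^ 2 := by
    have e := congrArg (PowerSeries.subst T) rdσ
    rw [subst_mul hs, subst_pow hs, subst_X hs, subst_mul hs, ← coe_substAlgHom hs, map_neg, map_add,
      map_mul, map_pow, coe_substAlgHom hs, C_subst' c, subst_X hs, subst_pow hs] at e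
    rw [hσT, V.logDeriv₂Num_subst hT0 hlog]
    change C ϖ ^ 2 * (logDeriv₂Num D σ).subst T * T ^ 2 = -(C ϖ ^ 2 * (XsT + C c * T ^ 2)) * σ.subst T ^ 2
    linear_combination C ϖ ^ 2 * e
  have rd1 : logDeriv₂Num D (σT ^ 2) * T ^ 2 = (-2 * (C ϖ ^ 2 * (XsT + C c * T ^ 2))) * (σT ^ 2) ^ 2 := by
    rw [logDeriv₂Num_sq]; linear_combination 2 * σT ^ 2 * rdσT
  have rdX2 : logDeriv₂Num D (X ^ 2) * X ^ 2 = (2 * κX) * (X ^ 2) ^ 2 := V.logDeriv₂Num_X_sq_ratio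
  have rdF := logDeriv₂Num_mul_ratio D rdX2 rd1
  have rdσ4 : logDeriv₂Num D (C ϖ ^ 2 * σ ^ 4) * X ^ 2 = (-4 * (Xs + C c * X ^ 2)) * (C ϖ ^ 2 * σ ^ 4) ^ 2 := by
    have hC : D (C ϖ ^ 2) = 0 := by rw [← map_pow, hD, formalInvariantDerivation_C]
    rw [logDeriv₂Num_const_mul D hC, show σ ^ 4 = (σ ^ 2) ^ 2 by ring, logDeriv₂Num_sq, logDeriv₂Num_sq]
    linear_combination (4 * C ϖ ^ 4 * σ ^ 6) * rdσ
  have rdA : logDeriv₂Num D A * (X ^ 2 * A) = (2 * κX * A + 2 * A ^ 2 - 2 * C t * X ^ 4) * A ^ 2 := by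
    have h := V.X_sq_mul_logDeriv₂Num_formalXMulSq_sub he ht
    rw [← hA, ← hD, ← hη, ← hκX] at h
    linear_combination A * h
  have rdG := logDeriv₂Num_mul_ratio D rdσ4 rdA
  -- the two second logarithmic derivatives agree
  have hκC : (C r₀ : ℚ_[p]⟦X⟧) + (C ϖ ^ 2 - 2) * C c - C e = 0 := by
    have := congrArg (C (R := ℚ_[p])) hκ
    simpa only [map_add, map_sub, map_mul, map_pow, map_ofNat, map_zero] using this
  have hagree : (2 * κX * T ^ 2 + -2 * (C ϖ ^ 2 * (XsT + C c * T ^ 2)) * X ^ 2) * (X ^ 2 * (X ^ 2 * A)) =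
      (-4 * (Xs + C c * X ^ 2) * (X ^ 2 * A) + (2 * κX * A + 2 * A ^ 2 - 2 * C t * X ^ 4) * X ^ 2) *
        (X ^ 2 * T ^ 2) := by
    rw [hA] at hx ⊢
    linear_combination (-2 * X ^ 4) * hx + (-2 * X ^ 6 * (Xs - C e * X ^ 2) * T ^ 2) * hκC
  -- hence `N(F)·G² = N(G)·F²`
  set F := X ^ 2 * σT ^ 2 with hF
  set G := C ϖ ^ 2 * σ ^ 4 * A with hG
  have hTne : T ≠ 0 := fun h => by rw [h, map_zero] at hT1; exact hϖ hT1.symm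
  have hAne : A ≠ 0 := fun h => by
    have := congrArg constantCoeff h
    rw [hA, map_sub, map_mul, map_pow, constantCoeff_X, constantCoeff_formalXMulSq, map_zero] at this
    norm_num at this
  have hNN : logDeriv₂Num D F * G ^ 2 = logDeriv₂Num D G * F ^ 2 := by
    have hd : (X ^ 2 * T ^ 2) * (X ^ 2 * (X ^ 2 * A)) ≠ 0 :=
      mul_ne_zero (mul_ne_zero (pow_ne_zero _ X_ne_zero) (pow_ne_zero _ hTne))
        (mul_ne_zero (pow_ne_zero _ X_ne_zero) (mul_ne_zero (pow_ne_zero _ X_ne_zero) hAne))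
    have e : (logDeriv₂Num D F * G ^ 2 - logDeriv₂Num D G * F ^ 2) *
        ((X ^ 2 * T ^ 2) * (X ^ 2 * (X ^ 2 * A))) = 0 := by
      rw [hF, hG]
      linear_combination (G ^ 2 * (X ^ 2 * (X ^ 2 * A))) * rdF - (F ^ 2 * (X ^ 2 * T ^ 2)) * rdG +
        (F ^ 2 * G ^ 2) * hagree
    exact sub_eq_zero.mp ((mul_eq_zero.mp e).resolve_right hd)
  -- leading data: `F = z⁴·f₀`, `G = z⁴·g₀`
  set sT := sigmaShift σT with hsT
  set s := sigmaShift σ with hss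
  have hXsT : X * sT = σT := X_mul_sigmaShift hσT0
  have hXs' : X * s = σ := X_mul_sigmaShift hσ0
  have hsT0 : constantCoeff sT = ϖ := by rw [hsT, constantCoeff_sigmaShift, hσT1]
  have hs0 : constantCoeff s = 1 := by rw [hss, constantCoeff_sigmaShift, hσ1]
  have hsT1 : 2 * coeff 1 sT = V.a₁ * ϖ := by rw [hsT, coeff_sigmaShift]; exact hσT2
  have hs1 : 2 * coeff 1 s = V.a₁ := by rw [hss, coeff_sigmaShift]; exact hσ2
  have hA0 : constantCoeff A = 1 := by
    rw [hA, map_sub, map_mul, map_pow, constantCoeff_X, constantCoeff_formalXMulSq]; norm_num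
  have hA1 : coeff 1 A = -V.a₁ := by
    rw [hA, map_sub, coeff_one_formalXMulSq, coeff_C_mul, coeff_X_pow, if_neg (by norm_num)]; ring
  have hFf : F = X ^ 4 * sT ^ 2 := by rw [hF, ← hXsT]; ring
  have hGg : G = X ^ 4 * (C ϖ ^ 2 * s ^ 4 * A) := by rw [hG, ← hXs']; ring
  have key : sT ^ 2 = C ϖ ^ 2 * s ^ 4 * A := by
    refine V.eq_of_logDeriv₂Num_X_pow_mul_eq 4 ?_ ?_ ?_ (by rw [← hFf, ← hGg]; exact hNN)
    · rw [map_pow, hsT0, map_mul, map_mul, ← map_pow C, constantCoeff_C, map_pow, hs0, hA0]; ring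
    · rw [map_mul, map_mul, ← map_pow C, constantCoeff_C, map_pow, hs0, hA0, one_pow, mul_one, mul_one]
      exact pow_ne_zero _ hϖ
    · -- `[z¹]`: `2ϖ·[z¹]sT = a₁ϖ²` vs `ϖ²(4[z¹]s + [z¹]A) = a₁ϖ²`
      have l1 : coeff 1 (sT ^ 2) = 2 * constantCoeff sT * coeff 1 sT := by
        rw [sq, coeff_one_mul_eq, coeff_zero_eq_constantCoeff_apply]; ring
      have l2 : coeff 1 (s ^ 4) = 4 * coeff 1 s := by
        have e2 : coeff 1 (s ^ 2) = 2 * coeff 1 s := by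
          rw [sq, coeff_one_mul_eq, coeff_zero_eq_constantCoeff_apply, hs0]; ring
        have e20 : constantCoeff (s ^ 2) = 1 := by rw [map_pow, hs0, one_pow]
        rw [show s ^ 4 = s ^ 2 * s ^ 2 by ring, coeff_one_mul_eq, coeff_zero_eq_constantCoeff_apply, e20, e2]
        ring
      have l3 : coeff 1 (C ϖ ^ 2 * s ^ 4 * A) = ϖ ^ 2 * (4 * coeff 1 s + coeff 1 A) := by
        rw [← map_pow, mul_assoc, coeff_C_mul, coeff_one_mul_eq, coeff_zero_eq_constantCoeff_apply,
          map_pow, hs0, one_pow, one_mul, coeff_zero_eq_constantCoeff_apply, hA0, mul_one, l2]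
        ring
      rw [l1, l3, hsT0, hA1]
      linear_combination ϖ * hsT1 - 2 * ϖ ^ 2 * hs1
  -- conclude
  calc X ^ 2 * σT ^ 2 = X ^ 4 * sT ^ 2 := hFf
    _ = X ^ 4 * (C ϖ ^ 2 * s ^ 4 * A) := by rw [key]
    _ = C ϖ ^ 2 * σ ^ 4 * A := hGg.symm

end FunctionalEquation

/-! ### §E. Integrality (Perrin-Riou's Lemme 2, squared) and the sigma-squared pair -/

section Integrality

variable {p : ℕ} [Fact p.Prime] (V : WeierstrassCurve ℚ_[p])

/-- The shift `T/z` of an integral series is integral. [folklore] -/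
private theorem isPadicInt_sigmaShift {T : ℚ_[p]⟦X⟧} (hT : IsPadicInt T) : IsPadicInt (sigmaShift T) := by
  rw [isPadicInt_iff_coeff] at hT ⊢
  intro n
  rw [coeff_sigmaShift]
  exact hT (n + 1)

/-- **Existence of the Mazur–Tate sigma-SQUARED pair from a CM `2`-isogeny datum (Perrin-Riou 1984,
Ch. III §1.2, Lemme 2 «everything squared»).** Let `V/ℚ_p` be a `p`-integral Weierstrass equation,
`σ = z + ⋯ ∈ ℚ_p⟦z⟧` a normalised ODD formal solution of the Mazur–Tate sigma equation
`x + c = -D(Dσ/σ)`, and suppose `V` carries a CM `2`-isogeny datum at the constant `c`: a series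
`T ∈ zℤ_p⟦z⟧` with `log_W(T) = ϖ·log_W`, `ϖ ∈ ℤ_pˣ` with `ϖᵐ - 2 ∈ ℤ_pˣ` for all `m ≥ 1` (automatic
for `p = 2`), a `2`-torsion abscissa `e ∈ ℤ_p`, the cleared `x`-relation
`ϖ²x(T) = x + t/(x - e) + r₀` and `c = (e - r₀)/(ϖ² - 2)`. Then **`(σ², c)` is a sigma-squared pair
of `V`** (`IsMazurTateSigmaSqPair`: `σ² ∈ z² + z³ℤ_p⟦z⟧`, even, and the squared sigma equation):
by the functional equation `z²σ(T)² = ϖ²σ⁴(X - ez²)` (`X_sq_mul_sq_subst_eq_of_cmTwoIsogeny`) the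
series `h = (σ/z)² ∈ 1 + zℚ_p⟦z⟧` satisfies `h(T) = h²·u` with `u = (X - ez²)·(ϖz/T)² ∈ ℤ_p⟦z⟧`,
hence `h ∈ ℤ_p⟦z⟧` by Perrin-Riou's argument (`UnitSubstitutionIntegrality`). This is how
«`σ_v(L_v(t))` comme série en `t` appartient à `t(1 + tR⟦t⟧)`» (Lemme 2) is proved in the source,
with `g_{π*}(t) = c·t^{1-p}u(t)` supplied here by the `2`-isogeny `x`-relation.
[cite: Perrinriou1984, Ch. III §1.2 Lemme 2] -/
theorem isMazurTateSigmaSqPair_sq_of_cmTwoIsogeny [V.IsIntegral ℤ_[p]] {σ T : ℚ_[p]⟦X⟧}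
    {c ϖ e t r₀ : ℚ_[p]}
    (hσ0 : constantCoeff σ = 0) (hσ1 : coeff 1 σ = 1) (hodd : V.IsFormallyOdd σ)
    (hODE : V.SatisfiesSigmaODE σ c) (hT0 : constantCoeff T = 0) (hT : IsPadicInt T)
    (hlog : V.formalLog.subst T = C ϖ * V.formalLog) (hϖ : ‖ϖ‖ = 1)
    (hunit : ∀ m : ℕ, 1 ≤ m → ‖ϖ ^ m - 2‖ = 1) (he1 : ‖e‖ ≤ 1)
    (he : 4 * e ^ 3 + V.b₂ * e ^ 2 + 2 * V.b₄ * e + V.b₆ = 0) (ht : 2 * t = 6 * e ^ 2 + V.b₂ * e + V.b₄)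
    (hx : C ϖ ^ 2 * V.formalXMulSq.subst T * (X ^ 2 * (V.formalXMulSq - C e * X ^ 2)) =
      T ^ 2 * (V.formalXMulSq * (V.formalXMulSq - C e * X ^ 2) + C t * X ^ 4 +
        C r₀ * X ^ 2 * (V.formalXMulSq - C e * X ^ 2)))
    (hκ : r₀ + (ϖ ^ 2 - 2) * c - e = 0) :
    V.IsMazurTateSigmaSqPair (σ ^ 2) c := by
  have hϖ0 : ϖ ≠ 0 := fun h => by rw [h, norm_zero] at hϖ; exact zero_ne_one hϖ
  have hs : HasSubst T := HasSubst.of_constantCoeff_zero' hT0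
  have hfe := V.X_sq_mul_sq_subst_eq_of_cmTwoIsogeny hσ0 hσ1 hodd hODE hT0 hlog hϖ0 he ht hx hκ
  have hT1 := V.coeff_one_of_formalLog_subst hT0 hlog
  set A := V.formalXMulSq - C e * X ^ 2 with hA
  -- `σ = z·s`, `h = s²`; `T = z·τ`, `τ = ϖ·τ₁`
  set sσ := sigmaShift σ with hsσ
  have hXs : X * sσ = σ := X_mul_sigmaShift hσ0
  have hs0 : constantCoeff sσ = 1 := by rw [hsσ, constantCoeff_sigmaShift, hσ1]
  set τ := sigmaShift T with hτ
  have hXτ : X * τ = T := X_mul_sigmaShift hT0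
  have hτ0 : constantCoeff τ = ϖ := by rw [hτ, constantCoeff_sigmaShift, hT1]
  set τ₁ := C ϖ⁻¹ * τ with hτ₁
  have hτ₁0 : constantCoeff τ₁ = 1 := by rw [hτ₁, map_mul, constantCoeff_C, hτ0, inv_mul_cancel₀ hϖ0]
  have hττ₁ : τ = C ϖ * τ₁ := by
    rw [hτ₁, ← mul_assoc, ← map_mul, mul_inv_cancel₀ hϖ0, map_one, one_mul]
  have hτ₁sq0 : constantCoeff (τ₁ ^ 2) = 1 := by rw [map_pow, hτ₁0, one_pow]
  have hτi : τ₁ ^ 2 * invOfUnit (τ₁ ^ 2) 1 = 1 := mul_invOfUnit _ 1 (by rw [hτ₁sq0, Units.val_one])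
  set iτ := invOfUnit (τ₁ ^ 2) 1 with hiτ
  set h := sσ ^ 2 with hh
  -- the functional equation for `h`: `h(T) = h²·(A·iτ)`
  have hfe' : h.subst T = h ^ 2 * (A * iτ) := by
    have e1 : X ^ 4 * (τ ^ 2 * h.subst T) = X ^ 4 * (C ϖ ^ 2 * h ^ 2 * A) := by
      have e := hfe
      rw [← hXs, subst_mul hs, subst_X hs] at e
      rw [hh, subst_pow hs]
      linear_combination e + (X ^ 2 * (sσ.subst T) ^ 2 * (X * τ + T)) * hXτ
    have e2 : τ ^ 2 * h.subst T = C ϖ ^ 2 * h ^ 2 * A :=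
      mul_left_cancel₀ (pow_ne_zero _ X_ne_zero) e1
    have e3 : τ₁ ^ 2 * h.subst T = h ^ 2 * A := by
      have hC : (C ϖ : ℚ_[p]⟦X⟧) ^ 2 ≠ 0 := pow_ne_zero _ (by rw [Ne, map_eq_zero_iff C (C_injective)]; exact hϖ0)
      refine mul_left_cancel₀ hC ?_
      rw [hττ₁] at e2
      linear_combination e2
    calc h.subst T = (τ₁ ^ 2 * iτ) * h.subst T := by rw [hτi, one_mul]
      _ = iτ * (τ₁ ^ 2 * h.subst T) := by ring
      _ = h ^ 2 * (A * iτ) := by rw [e3]; ring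
  -- integrality of the data
  have hτint : IsPadicInt τ := isPadicInt_sigmaShift hT
  have hτ₁int : IsPadicInt τ₁ := by
    rw [hτ₁]
    exact (IsPadicInt.C (by rw [norm_inv, hϖ, inv_one])).mul hτint
  have hiτint : IsPadicInt iτ := (hτ₁int.pow 2).invOfUnit_one hτ₁sq0
  have hAint : IsPadicInt A := by
    rw [hA]
    exact V.isPadicInt_formalXMulSq.sub ((IsPadicInt.C he1).mul (IsPadicInt.powerSeries_X.pow 2))
  have hh0 : constantCoeff h = 1 := by rw [hh, map_pow, hs0, one_pow]
  have hunit' : ∀ m : ℕ, 1 ≤ m → ‖coeff 1 T ^ m - ((2 : ℕ) : ℚ_[p])‖ = 1 := fun m hm => by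
    rw [hT1, Nat.cast_ofNat]; exact hunit m hm
  have hhint : IsPadicInt h :=
    Literature.RingTheory.FormalGroups.isPadicInt_of_subst_eq_pow_mul (N := 2) hh0 hT0 hT
      (hAint.mul hiτint) hunit' hfe'
  -- `σ² = z²·h ∈ z² + z³ℤ_p⟦z⟧`
  have hσsq : σ ^ 2 = X ^ 2 * h := by rw [hh, ← hXs]; ring
  have hσsqint : IsPadicInt (σ ^ 2) := by
    rw [hσsq]; exact (IsPadicInt.powerSeries_X.pow 2).mul hhint
  exact
    { constantCoeff_eq := by rw [map_pow, hσ0, zero_pow two_ne_zero]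
      coeff_one_eq := by
        rw [sq, coeff_one_mul_eq, coeff_zero_eq_constantCoeff_apply, hσ0, zero_mul, mul_zero, add_zero]
      coeff_two_eq := by rw [coeff_two_sq_of_constantCoeff_eq_zero hσ0, hσ1, one_pow]
      norm_coeff_le := isPadicInt_iff_coeff.mp hσsqint
      even := hodd.sq
      ode := SatisfiesSigmaODE.sq hσ0 hσ1 hODE }

/-- **The `p = 2` case** (the one that matters: `N(π*) = 2 = p`, `π*` a `2`-adic unit — the
CM curves with potentially good ORDINARY reduction at `2`, i.e. CM by `ℚ(√-7)`): the unit condition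
`‖ϖᵐ - 2‖ = 1` is automatic. [cite: Perrinriou1984, Ch. III §1.2 Lemme 2] -/
theorem isMazurTateSigmaSqPair_sq_of_cmTwoIsogeny_two (V : WeierstrassCurve ℚ_[2]) [V.IsIntegral ℤ_[2]]
    {σ T : ℚ_[2]⟦X⟧} {c ϖ e t r₀ : ℚ_[2]}
    (hσ0 : constantCoeff σ = 0) (hσ1 : coeff 1 σ = 1) (hodd : V.IsFormallyOdd σ)
    (hODE : V.SatisfiesSigmaODE σ c) (hT0 : constantCoeff T = 0) (hT : IsPadicInt T)
    (hlog : V.formalLog.subst T = C ϖ * V.formalLog) (hϖ : ‖ϖ‖ = 1) (he1 : ‖e‖ ≤ 1)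
    (he : 4 * e ^ 3 + V.b₂ * e ^ 2 + 2 * V.b₄ * e + V.b₆ = 0) (ht : 2 * t = 6 * e ^ 2 + V.b₂ * e + V.b₄)
    (hx : C ϖ ^ 2 * V.formalXMulSq.subst T * (X ^ 2 * (V.formalXMulSq - C e * X ^ 2)) =
      T ^ 2 * (V.formalXMulSq * (V.formalXMulSq - C e * X ^ 2) + C t * X ^ 4 +
        C r₀ * X ^ 2 * (V.formalXMulSq - C e * X ^ 2)))
    (hκ : r₀ + (ϖ ^ 2 - 2) * c - e = 0) :
    V.IsMazurTateSigmaSqPair (σ ^ 2) c := by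
  refine V.isMazurTateSigmaSqPair_sq_of_cmTwoIsogeny hσ0 hσ1 hodd hODE hT0 hT hlog hϖ (fun m _ => ?_)
    he1 he ht hx hκ
  have h2 : ‖(2 : ℚ_[2])‖ < 1 := by exact_mod_cast Padic.norm_p_lt_one (p := 2)
  have hwm : ‖ϖ ^ m‖ = 1 := by rw [norm_pow, hϖ, one_pow]
  have hne : ‖ϖ ^ m‖ ≠ ‖(-(2 : ℚ_[2]))‖ := by rw [hwm, norm_neg]; exact h2.ne'
  rw [sub_eq_add_neg, Padic.add_eq_max_of_ne hne, hwm, norm_neg, max_eq_left h2.le]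

end Integrality

end WeierstrassCurve
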